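import Literature.GroupTheory.CombinatorialGroupTheory.AmalgamReducedWords
import Mathlib.GroupTheory.FreeGroup.CyclicallyReduced
import Mathlib.Algebra.Order.BigOperators.Group.List
import HarnessLib

/-!
# Baumslag's combination lemma: an amalgam `A *_ℤ B` of discriminated groups is discriminated

Topic `Literature/GroupTheory/CombinatorialGroupTheory`; theorems only, over Mathlib's
`Monoid.PushoutI φ` with two factors (`ι = Bool`) amalgamated along `φ b : ℤ → G b`
(`Multiplicative ℤ`), continuing `AmalgamReducedWords.lean`.  This is the mechanism of
G. Baumslag, *On generalised free products*, Math. Z. 78 (1962), Thm. 1 / Prop. 1 (residual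
freeness of the double of a free group; Lyndon–Schupp Ch. I §7 around Prop. 7.?; also the first
"combination theorem" for fully residually free groups):

* the **twisted lifts** `PushoutI.lift` of a pair of factor homomorphisms `f b : G b → F` agreeing
  on `ℤ ↦ ⟨z⟩`, with the factor `true` precomposed with conjugation by `φ true (m)` (an
  algebraic Dehn twist along the amalgamated `ℤ`): `twist_compat`, `twistLift_of`,
  `twistLift_base`, `twistLift_lprod`;
* `exists_twistLift_forall_ne_one` — **combination lemma**: if every factor is *discriminated*
  by a family of homomorphisms to the free group `F` that send the amalgamated generator to a
  fixed `z ≠ 1`, and no element of a factor outside the amalgamated subgroup commutes with it,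
  then for every finite list of non-trivial elements of the amalgam some twisted lift kills none
  of them — GIVEN the *big powers property* of `z` (hypothesis `hBP`, Baumslag 1962 Prop. 1;
  supplied for free groups by `FreeGroupBigPowers.lean`): a reduced word `c · g₁ ⋯ g_n` goes to
  `z^c · Π z^{m tⱼ} f(gⱼ) z^{-m tⱼ}` with alternating `tⱼ ∈ {0, 1}` and `f(gⱼ) ∉ C(z)`, which is
  `≠ 1` for `|m|` large.

## References

* G. Baumslag, *On generalised free products*, Math. Z. 78 (1962), 423–438, Thm. 1, Prop. 1.
  [Baumslag1962]
* R. C. Lyndon, P. E. Schupp, *Combinatorial Group Theory*, Springer (1977); Classics in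
  Mathematics (2001), Ch. IV §2. [LyndonSchupp2001]
-/

namespace Literature.GroupTheory.CombinatorialGroupTheory

namespace Amalgam

open Monoid Monoid.PushoutI

variable {G : Bool → Type*} [∀ b, Group (G b)] {φ : ∀ b, Multiplicative ℤ →* G b} {κ : Type*}

/-- The value in `PushoutI φ` of a letter list. -/
local notation3 "ℓπ[" φ "] " l:max =>
  List.prod (List.map (fun x => Monoid.PushoutI.of (φ := φ) (Sigma.fst x) (Sigma.snd x)) l)

/-! ### Twisted lifts -/

/-- The twisting exponent of the factor `b`: `0` on the factor `false`, `m` on the factor `true`.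
We write it inline as `m * b.toNat`. Compatibility of the twisted factor homomorphisms on the
amalgamated `ℤ` (which is commutative). [cite: Baumslag1962, Thm. 1] -/
theorem twist_compat (f : ∀ b, G b →* FreeGroup κ) (z : FreeGroup κ)
    (hf : ∀ b, (f b).comp (φ b) = zpowersHom _ z) (m : ℤ) (b : Bool) :
    ((f b).comp (MulAut.conj (φ b (Multiplicative.ofAdd (m * (b.toNat : ℤ))))).toMonoidHom).comp
      (φ b) = zpowersHom _ z := by
  ext
  simp only [MonoidHom.comp_apply, MulEquiv.coe_toMonoidHom, MulAut.conj_apply, ← map_inv,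
    ← map_mul, mul_inv_cancel_comm]
  exact DFunLike.congr_fun (hf b) _

/-- The twisted lift on a letter: `Φ(g) = z^{m t} · f(g) · z^{-m t}`, `t = b.toNat`.
[cite: Baumslag1962, Thm. 1] -/
theorem twistLift_of (f : ∀ b, G b →* FreeGroup κ) (z : FreeGroup κ)
    (hf : ∀ b, (f b).comp (φ b) = zpowersHom _ z) (m : ℤ) (b : Bool) (g : G b) :
    PushoutI.lift (fun b => (f b).comp
        (MulAut.conj (φ b (Multiplicative.ofAdd (m * (b.toNat : ℤ))))).toMonoidHom)
      (zpowersHom _ z) (twist_compat f z hf m) (of b g) =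
      z ^ (m * (b.toNat : ℤ)) * f b g * z ^ (-(m * (b.toNat : ℤ))) := by
  have hz : f b (φ b (Multiplicative.ofAdd (m * (b.toNat : ℤ)))) = z ^ (m * (b.toNat : ℤ)) := by
    have := DFunLike.congr_fun (hf b) (Multiplicative.ofAdd (m * (b.toNat : ℤ)))
    simpa using this
  rw [PushoutI.lift_of]
  simp only [MonoidHom.comp_apply, MulEquiv.coe_toMonoidHom, MulAut.conj_apply, map_mul, map_inv, hz,
    zpow_neg]

/-- The twisted lift on the base group: `Φ(c) = z ^ c`. [cite: Baumslag1962, Thm. 1] -/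
theorem twistLift_base (f : ∀ b, G b →* FreeGroup κ) (z : FreeGroup κ)
    (hf : ∀ b, (f b).comp (φ b) = zpowersHom _ z) (m : ℤ) (c : Multiplicative ℤ) :
    PushoutI.lift (fun b => (f b).comp
        (MulAut.conj (φ b (Multiplicative.ofAdd (m * (b.toNat : ℤ))))).toMonoidHom)
      (zpowersHom _ z) (twist_compat f z hf m) (base φ c) = z ^ c.toAdd := by
  rw [PushoutI.lift_base, zpowersHom_apply]

/-- The twisted lift on the value of a letter list. [cite: Baumslag1962, Thm. 1] -/
theorem twistLift_lprod (f : ∀ b, G b →* FreeGroup κ) (z : FreeGroup κ)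
    (hf : ∀ b, (f b).comp (φ b) = zpowersHom _ z) (m : ℤ) (l : List (Σ b, G b)) :
    PushoutI.lift (fun b => (f b).comp
        (MulAut.conj (φ b (Multiplicative.ofAdd (m * (b.toNat : ℤ))))).toMonoidHom)
      (zpowersHom _ z) (twist_compat f z hf m) (ℓπ[φ] l) =
      ((l.map fun x => ((x.1, f x.1 x.2) : Bool × FreeGroup κ)).map fun y =>
        z ^ (m * (y.1.toNat : ℤ)) * y.2 * z ^ (-(m * (y.1.toNat : ℤ)))).prod := by
  rw [map_list_prod, List.map_map, List.map_map]
  refine congrArg List.prod (List.map_congr_left fun x _ => ?_)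
  rw [Function.comp_apply, Function.comp_apply]
  exact twistLift_of f z hf m x.1 x.2

/-! ### The combination lemma -/

/-- Letters of a reduced word do not lie in the amalgamated subgroup, hence (hypothesis `hcen`)
do not commute with its generator; a factor homomorphism that does not kill the commutator sends
the letter outside the centralizer of `z`. [cite: Baumslag1962, Thm. 1] -/
theorem not_commute_map_of_ne_one {b : Bool} (f : G b →* FreeGroup κ) (z : FreeGroup κ)
    (hf : f.comp (φ b) = zpowersHom _ z) {g : G b}
    (h : f (g * φ b (Multiplicative.ofAdd 1) * g⁻¹ * (φ b (Multiplicative.ofAdd 1))⁻¹) ≠ 1) :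
    ¬ Commute (f g) z := by
  intro hc
  apply h
  have hz : f (φ b (Multiplicative.ofAdd 1)) = z := by
    have := DFunLike.congr_fun hf (Multiplicative.ofAdd 1)
    simpa using this
  rw [map_mul, map_mul, map_mul, map_inv, map_inv, hz, hc.eq, mul_inv_cancel_right, mul_inv_cancel]

/-- **Baumslag's combination lemma for `A *_ℤ B`** (given the big powers property `hBP` of
`z`).  Hypotheses: injective structure maps; `hcen` — no element of a factor outside the
amalgamated subgroup commutes with its generator; `hdisc` — each factor is discriminated by the
family `𝓕 b` of homomorphisms to `F` which restrict to `n ↦ zⁿ` on the amalgamated `ℤ`.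
Conclusion: every finite list of non-trivial elements of the amalgam is mapped to non-trivial
elements by some twisted lift. [cite: Baumslag1962, Thm. 1] -/
theorem exists_twistLift_forall_ne_one (hφ : ∀ b, Function.Injective (φ b)) (z : FreeGroup κ)
    (hz : z ≠ 1)
    (hBP : ∀ (c : ℤ) (ys : List (Bool × FreeGroup κ)), ys ≠ [] →
      ys.IsChain (fun a b => a.1 ≠ b.1) → (∀ y ∈ ys, ¬ Commute y.2 z) →
      ∃ N : ℕ, ∀ m : ℤ, (N : ℤ) ≤ |m| →
        z ^ c * (ys.map fun y => z ^ (m * (y.1.toNat : ℤ)) * y.2 * z ^ (-(m * (y.1.toNat : ℤ)))).prod ≠ 1)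
    (hcen : ∀ (b : Bool) (g : G b), g ∉ (φ b).range →
      g * φ b (Multiplicative.ofAdd 1) * g⁻¹ * (φ b (Multiplicative.ofAdd 1))⁻¹ ≠ 1)
    (𝓕 : ∀ b : Bool, (G b →* FreeGroup κ) → Prop)
    (h𝓕 : ∀ b f, 𝓕 b f → f.comp (φ b) = zpowersHom _ z)
    (hdisc : ∀ (b : Bool) (L : List (G b)), (∀ x ∈ L, x ≠ 1) → ∃ f, 𝓕 b f ∧ ∀ x ∈ L, f x ≠ 1)
    (S : List (PushoutI φ)) (hS : ∀ s ∈ S, s ≠ 1) :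
    ∃ (f : ∀ b, G b →* FreeGroup κ) (_ : ∀ b, 𝓕 b (f b))
      (hf : ∀ b, (f b).comp (φ b) = zpowersHom _ z) (m : ℤ),
      ∀ s ∈ S, PushoutI.lift (fun b => (f b).comp
          (MulAut.conj (φ b (Multiplicative.ofAdd (m * (b.toNat : ℤ))))).toMonoidHom)
        (zpowersHom _ z) (twist_compat f z hf m) s ≠ 1 := by
  classical
  -- reduced forms of the elements of `S`
  have hred := fun s : PushoutI φ => exists_reduced_eq hφ s
  choose cf lf hlc hlr hse using hred
  -- the letters of all these words, sorted by factor, and their commutators with the generator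
  let letF : List (G false) := (S.flatMap lf).filterMap fun x => match x with
    | ⟨false, g⟩ => some g | ⟨true, _⟩ => none
  let letT : List (G true) := (S.flatMap lf).filterMap fun x => match x with
    | ⟨true, g⟩ => some g | ⟨false, _⟩ => none
  have memF : ∀ s ∈ S, ∀ g : G false, (⟨false, g⟩ : Σ b, G b) ∈ lf s → g ∈ letF := by
    intro s hs g hg
    exact List.mem_filterMap.2 ⟨⟨false, g⟩, List.mem_flatMap.2 ⟨s, hs, hg⟩, rfl⟩
  have memT : ∀ s ∈ S, ∀ g : G true, (⟨true, g⟩ : Σ b, G b) ∈ lf s → g ∈ letT := by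
    intro s hs g hg
    exact List.mem_filterMap.2 ⟨⟨true, g⟩, List.mem_flatMap.2 ⟨s, hs, hg⟩, rfl⟩
  have offF : ∀ g ∈ letF, g ∉ (φ false).range := by
    intro g hg
    obtain ⟨x, hx, hxg⟩ := List.mem_filterMap.1 hg
    obtain ⟨s, hs, hxs⟩ := List.mem_flatMap.1 hx
    rcases x with ⟨_ | _, g'⟩
    · simp only [Option.some.injEq] at hxg; subst hxg; exact hlr s _ hxs
    · simp at hxg
  have offT : ∀ g ∈ letT, g ∉ (φ true).range := by
    intro g hg
    obtain ⟨x, hx, hxg⟩ := List.mem_filterMap.1 hg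
    obtain ⟨s, hs, hxs⟩ := List.mem_flatMap.1 hx
    rcases x with ⟨_ | _, g'⟩
    · simp at hxg
    · simp only [Option.some.injEq] at hxg; subst hxg; exact hlr s _ hxs
  -- choose the factor homomorphisms
  obtain ⟨f₀, hf₀F, hf₀⟩ := hdisc false
    (letF.map fun g => g * φ false (Multiplicative.ofAdd 1) * g⁻¹ * (φ false (Multiplicative.ofAdd 1))⁻¹)
    (by
      intro x hx
      obtain ⟨g, hg, rfl⟩ := List.mem_map.1 hx
      exact hcen false g (offF g hg))
  obtain ⟨f₁, hf₁F, hf₁⟩ := hdisc true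
    (letT.map fun g => g * φ true (Multiplicative.ofAdd 1) * g⁻¹ * (φ true (Multiplicative.ofAdd 1))⁻¹)
    (by
      intro x hx
      obtain ⟨g, hg, rfl⟩ := List.mem_map.1 hx
      exact hcen true g (offT g hg))
  let f : ∀ b, G b →* FreeGroup κ := fun b => Bool.rec (motive := fun b => G b →* FreeGroup κ) f₀ f₁ b
  have hfF : ∀ b, 𝓕 b (f b) := fun b => by cases b <;> assumption
  have hf : ∀ b, (f b).comp (φ b) = zpowersHom _ z := fun b => h𝓕 b _ (hfF b)
  -- every letter of every word goes outside the centralizer of `z`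
  have hnc : ∀ s ∈ S, ∀ x ∈ lf s, ¬ Commute (f x.1 x.2) z := by
    intro s hs x hx
    obtain ⟨b, g⟩ := x
    cases b with
    | false =>
      exact not_commute_map_of_ne_one (f false) z (hf false)
        (hf₀ _ (List.mem_map.2 ⟨g, memF s hs g hx, rfl⟩))
    | true =>
      exact not_commute_map_of_ne_one (f true) z (hf true)
        (hf₁ _ (List.mem_map.2 ⟨g, memT s hs g hx, rfl⟩))
  -- a bound `N s` for each element of `S`
  have key : ∀ s : PushoutI φ, ∃ N : ℕ, s ∈ S → ∀ m : ℤ, (N : ℤ) ≤ |m| →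
      PushoutI.lift (fun b => (f b).comp
          (MulAut.conj (φ b (Multiplicative.ofAdd (m * (b.toNat : ℤ))))).toMonoidHom)
        (zpowersHom _ z) (twist_compat f z hf m) s ≠ 1 := by
    intro s
    by_cases hs : s ∈ S
    · by_cases hl : lf s = []
      · -- `s = base c`, `c ≠ 0`
        refine ⟨0, fun _ m _ => ?_⟩
        rw [hse s, hl, map_mul, twistLift_base f z hf m]
        simp only [List.map_nil, List.prod_nil, map_one, mul_one]
        intro h
        have hc : (cf s).toAdd = 0 := by
          by_contra hc
          exact hz ((IsMulTorsionFree.zpow_eq_one_iff_left hc).1 h)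
        apply hS s hs
        rw [hse s, hl]
        simp [show cf s = 1 from toAdd_eq_zero.1 hc]
      · obtain ⟨N, hN⟩ := hBP (cf s).toAdd
          ((lf s).map fun x : (Σ b, G b) => ((x.1, f x.1 x.2) : Bool × FreeGroup κ))
          (by simpa using hl)
          (by
            have := hlc s
            rw [List.isChain_map]
            exact this)
          (by
            intro y hy
            obtain ⟨x, hx, rfl⟩ := List.mem_map.1 hy
            exact hnc s hs x hx)
        refine ⟨N, fun _ m hm => ?_⟩
        rw [hse s, map_mul, twistLift_base f z hf m, twistLift_lprod f z hf m]
        exact hN m hm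
    · exact ⟨0, fun h => absurd h hs⟩
  choose N hN using key
  refine ⟨f, hfF, hf, ((S.map N).sum : ℕ), fun s hs => hN s hs _ ?_⟩
  refine le_trans ?_ (le_abs_self _)
  exact_mod_cast List.le_sum_of_mem (List.mem_map.2 ⟨s, hs, rfl⟩)

end Amalgam

end Literature.GroupTheory.CombinatorialGroupTheory
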